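import Mathlib
import HarnessLib
import Summits.HubbardSuperconductivity.HubbardSuperconductivity.Theorems.KLProgrammeKLRegimeTwoVolumeTowerStepCovData
import Summits.HubbardSuperconductivity.HubbardSuperconductivity.Theorems.KLProgrammeKLRegimeTwoVolumeTowerSpineDefs
import Summits.HubbardSuperconductivity.HubbardSuperconductivity.Theorems.KLProgrammeKLRegimeTwoVolumeSectorBlockShift
import Summits.HubbardSuperconductivity.HubbardSuperconductivity.Theorems.KLProgrammeKLRegimeTwoVolumeDataKitWt

/-!
# K3 VL child `KLRegimeVolumeLimitV17F2` (stmt-HubbardSuperconductivity-20440), blueprint v5 M3b-j (iii) IN THE TOWER'S VOCABULARY: the transfer bundle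
# `TransferWtData (klTowerTransfer (b·L) M β μ K_n j) (klBlockEquivD L b M j) (klBlockEquivD L b M (j−1)) Λ_T Cw` at the canonical block structures

Cell `gate-hubbard-kl`, seat p3 (g13).  The W5 tower spine (`…TwoVolumeTowerSpineDefs.TowerCrossData.transfer`, k3c4-p1 g13) reads, for every step
`j ≤ J` of the fine volume `b·L` AT THE COARSE FRAME `Kc`, the bundle `TransferWtData (klTowerTransfer (b·L) M β μ Kc j) (klBlockEquivD L b M j)
(klBlockEquivD L b M (j−1)) (Λ_T j) (cW j)` of `…TwoVolumeSpineDataDefs`: Λ_T-scaled weighted rows and columns of the transfer and its BLOCK COVARIANCE under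
the canonical doubled block structures `klBlockEquivD`.  This file discharges it from landed theorems:

* §1 `transferWtData_one` — the identity transfer (`klTowerTransfer … 0 = 1`): rows and columns `= 1`, block covariance by injectivity of the block structure;
* §2 the doubled transfer `T⁺_k = klSrcTransfer = klReanalysis ⊕ klSlotShift` at ANY frame `K`: the slot-shift block has weighted rows/columns `≤ 1`
  (`sum_norm_klSlotShift_mul_wt_row_le / _col_le`: one nonzero entry, at displacement `0`); the re-analysis block `ε•E(F_{k+1}[K])·S(F̃_k[K])` is block covariant
  for the canonical structures (`norm_klReanalysis_blockCovariant`, from k3c4-p1 g8 `norm_sectorOverlap_blockCovariant` at `klBlockEquiv_val/_snd`) and so is the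
  slot shift (`klSlotShift_blockCovariant`, from `sectorBlock_symm_add_eq`); hence **`transferWtData_klSrcTransfer_of_rowColSumWt`** — `TransferWtData (klSrcTransfer
  (b·L) M β μ K k) (klBlockEquivD L b M (k+1)) (klBlockEquivD L b M k) Λ_T (Cr + 1)` from `klScaleWt (k+1)`-weighted row and column sums `≤ Cr` of
  `klReanalysis (b·L) M β μ K k`, every `0 ≤ Λ_T ≤ Λ_{k+1}` (frame-generic: serves the fine frame and the `_at` frames alike);
* §3 **`transferWtData_klTowerTransfer_klEng_flow_deep_vol (d)`** — the door at the coarse flow frame `K_n = klFlowFrameU L M β U μ n`: ONE constant `Cw ≥ 1` with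
  `TransferWtData (klTowerTransfer (b·L) M β μ K_n j) (klBlockEquivD L b M j) (klBlockEquivD L b M (j−1)) Λ_T Cw` for every `j ≤ n` (deep window
  `4ⁿ·U ≤ 4^{2j+d}` when `1 ≤ j`), every `0 ≤ Λ_T ≤ Λ_j`, every fine lattice `klEngL₃ β U ≤ b·L` — the rows/columns at `j = k+1` are p3 g12's ε-free
  `rowColSumWt_klReanalysis_klEng_flow_deep_vol (d)`.

Everything is proved; no definitions; nothing asserts any stub, K3, VL or superconductivity. [cite: BenfattoGiulianiMastropietro2006, §2.7 (2.70)–(2.71a), §3 (3.2)–(3.8)]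
-/

noncomputable section

namespace Summit.HubbardSuperconductivity.HubbardSuperconductivity.Theorems.TorusFourierL2

set_option linter.dupNamespace false -- summit = problem name (single-conjunct summit), D-0017

open Set Finset Literature.MathematicalPhysics.QuantumLattice Literature.MathematicalPhysics.QuantumLattice.BandSectorCounting
open Literature.MathematicalPhysics.QuantumLattice.FermiRG Literature.Probability.LatticeModels Literature.Analysis.SpecialFunctions
open Summit.HubbardSuperconductivity.HubbardSuperconductivity.Theorems.DispersionFlow
open Summit.HubbardSuperconductivity.HubbardSuperconductivity.Theorems.KLRegimeSplit
open Summit.HubbardSuperconductivity.HubbardSuperconductivity.Theorems.KLProgrammeLegKernels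
open Summit.HubbardSuperconductivity.HubbardSuperconductivity.Theorems.PerturbedFermiCurve
open Summit.HubbardSuperconductivity.HubbardSuperconductivity.Theorems.KLRegimeWick
open Summit.HubbardSuperconductivity.HubbardSuperconductivity.Theorems.EngineV8
open Summit.HubbardSuperconductivity.HubbardSuperconductivity.Theorems.TwoVolumeSource
open Summit.HubbardSuperconductivity.HubbardSuperconductivity.Theorems.TwoVolumeDefect
open Summit.HubbardSuperconductivity.HubbardSuperconductivity.Theorems.TwoPointAssembly
open scoped Real Nat

open Classical

/-! ## §1 The identity transfer -/

/-- **The identity transfer carries `TransferWtData`** for every block structure `ed` (taken on both sides), every rate `Λ_T ≥ 0` and every `cW ≥ 1`: its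
weighted rows and columns are `= 1` (one entry, displacement `0`) and it is block covariant by injectivity of `ed⁻¹`. [folklore] -/
theorem transferWtData_one {b L Lf M N : ℕ} [NeZero L] [NeZero Lf]
    (ed : ((SpaceTimeIdx Lf M × SectorLeg N) × Fin 2) ≃ (Fin 2 → Fin b) × ((SpaceTimeIdx L M × SectorLeg N) × Fin 2))
    {ΛT cW : ℝ} (hΛT : 0 ≤ ΛT) (hcW : 1 ≤ cW) :
    TransferWtData (1 : Matrix ((SpaceTimeIdx Lf M × SectorLeg N) × Fin 2) ((SpaceTimeIdx Lf M × SectorLeg N) × Fin 2) ℂ) ed ed ΛT cW where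
  ΛT_nonneg := hΛT
  cW_nonneg := zero_le_one.trans hcW
  row x := by
    rw [Finset.sum_eq_single x]
    · rw [Matrix.one_apply_eq, norm_one, one_mul, sub_self, SourceGas.tnorm_zero, Nat.cast_zero, mul_zero, add_zero]; exact hcW
    · intro y' _ hne; rw [Matrix.one_apply_ne' hne, norm_zero, zero_mul]
    · intro h; exact absurd (Finset.mem_univ x) h
  col y' := by
    rw [Finset.sum_eq_single y']
    · rw [Matrix.one_apply_eq, norm_one, one_mul, sub_self, SourceGas.tnorm_zero, Nat.cast_zero, mul_zero, add_zero]; exact hcW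
    · intro x _ hne; rw [Matrix.one_apply_ne hne, norm_zero, zero_mul]
    · intro h; exact absurd (Finset.mem_univ y') h
  cov δ β' β xbar y := by
    simp only [Matrix.one_apply, ed.symm.injective.eq_iff, Prod.mk.injEq, add_left_inj]

/-! ## §2 The doubled transfer `T⁺_k` at a frame -/

section SrcTransfer

variable {V M : ℕ} [NeZero V]

/-- Entries of `T⁺_k` between the two re-analysis copies `0`: the re-analysis block. [folklore] -/
theorem klSrcTransfer_apply_zero_zero (β μ : ℝ) (K : TrigPolyC4v) (k : ℕ) (X'' : SpaceTimeIdx V M × SectorLeg (sectorCount (k + 1)))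
    (X' : SpaceTimeIdx V M × SectorLeg (sectorCount k)) :
    klSrcTransfer V M β μ K k (X'', 0) (X', 0) = klReanalysis V M β μ K k X'' X' := by
  rw [klSrcTransfer_apply, if_pos ⟨rfl, rfl⟩]

/-- Entries of `T⁺_k` between the two source copies `1`: the slot shift. [folklore] -/
theorem klSrcTransfer_apply_one_one (β μ : ℝ) (K : TrigPolyC4v) (k : ℕ) (X'' : SpaceTimeIdx V M × SectorLeg (sectorCount (k + 1)))
    (X' : SpaceTimeIdx V M × SectorLeg (sectorCount k)) :
    klSrcTransfer V M β μ K k (X'', 1) (X', 1) = klSlotShift V M k X'' X' := by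
  rw [klSrcTransfer_apply]; dsimp only; rw [if_neg (by decide), if_pos ⟨rfl, rfl⟩]

/-- Entries of `T⁺_k` from copy `0` to copy `1` vanish. [folklore] -/
theorem klSrcTransfer_apply_zero_one (β μ : ℝ) (K : TrigPolyC4v) (k : ℕ) (X'' : SpaceTimeIdx V M × SectorLeg (sectorCount (k + 1)))
    (X' : SpaceTimeIdx V M × SectorLeg (sectorCount k)) :
    klSrcTransfer V M β μ K k (X'', 0) (X', 1) = 0 := by
  rw [klSrcTransfer_apply]; dsimp only; rw [if_neg (by decide), if_neg (by decide)]

/-- Entries of `T⁺_k` from copy `1` to copy `0` vanish. [folklore] -/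
theorem klSrcTransfer_apply_one_zero (β μ : ℝ) (K : TrigPolyC4v) (k : ℕ) (X'' : SpaceTimeIdx V M × SectorLeg (sectorCount (k + 1)))
    (X' : SpaceTimeIdx V M × SectorLeg (sectorCount k)) :
    klSrcTransfer V M β μ K k (X'', 1) (X', 0) = 0 := by
  rw [klSrcTransfer_apply]; dsimp only; rw [if_neg (by decide), if_neg (by decide)]

/-- **The slot shift has weighted rows `≤ 1`**: at most one nonzero entry (value `1`), at displacement `0`. [folklore] -/
theorem sum_norm_klSlotShift_mul_wt_row_le (k : ℕ) (ΛT : ℝ) (X'' : SpaceTimeIdx V M × SectorLeg (sectorCount (k + 1))) :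
    ∑ X' : SpaceTimeIdx V M × SectorLeg (sectorCount k), ‖klSlotShift V M k X'' X'‖ * (1 + ΛT * (Torus.tnorm (X''.1.2 - X'.1.2) : ℝ)) ≤ 1 := by
  set X₀ : SpaceTimeIdx V M × SectorLeg (sectorCount k) := (X''.1, ((⟨0, sectorCount_pos k⟩, X''.2.1.2), X''.2.2)) with hX₀
  calc ∑ X' : SpaceTimeIdx V M × SectorLeg (sectorCount k), ‖klSlotShift V M k X'' X'‖ * (1 + ΛT * (Torus.tnorm (X''.1.2 - X'.1.2) : ℝ))
      ≤ ∑ X' : SpaceTimeIdx V M × SectorLeg (sectorCount k), (if X' = X₀ then (1 : ℝ) else 0) := by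
        refine Finset.sum_le_sum fun X' _ => ?_
        rw [klSlotShift_apply]
        split_ifs with h hX
        · obtain ⟨h1, -, -, -, -⟩ := h
          rw [norm_one, one_mul, h1, sub_self, SourceGas.tnorm_zero, Nat.cast_zero, mul_zero, add_zero]
        · exfalso; apply hX
          obtain ⟨h1, -, h3, h4, h5⟩ := h
          exact Prod.ext h1.symm (Prod.ext (Prod.ext (Fin.ext h3) h4.symm) h5.symm)
        · rw [norm_zero, zero_mul]; exact zero_le_one
        · rw [norm_zero, zero_mul]
    _ = 1 := by rw [Finset.sum_ite_eq' Finset.univ X₀ (fun _ => (1 : ℝ)), if_pos (Finset.mem_univ _)]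

/-- **The slot shift has weighted columns `≤ 1`.** [folklore] -/
theorem sum_norm_klSlotShift_mul_wt_col_le (k : ℕ) (ΛT : ℝ) (X' : SpaceTimeIdx V M × SectorLeg (sectorCount k)) :
    ∑ X'' : SpaceTimeIdx V M × SectorLeg (sectorCount (k + 1)), ‖klSlotShift V M k X'' X'‖ * (1 + ΛT * (Torus.tnorm (X''.1.2 - X'.1.2) : ℝ)) ≤ 1 := by
  set X₀ : SpaceTimeIdx V M × SectorLeg (sectorCount (k + 1)) := (X'.1, ((⟨0, sectorCount_pos (k + 1)⟩, X'.2.1.2), X'.2.2)) with hX₀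
  calc ∑ X'' : SpaceTimeIdx V M × SectorLeg (sectorCount (k + 1)), ‖klSlotShift V M k X'' X'‖ * (1 + ΛT * (Torus.tnorm (X''.1.2 - X'.1.2) : ℝ))
      ≤ ∑ X'' : SpaceTimeIdx V M × SectorLeg (sectorCount (k + 1)), (if X'' = X₀ then (1 : ℝ) else 0) := by
        refine Finset.sum_le_sum fun X'' _ => ?_
        rw [klSlotShift_apply]
        split_ifs with h hX
        · obtain ⟨h1, -, -, -, -⟩ := h
          rw [norm_one, one_mul, h1, sub_self, SourceGas.tnorm_zero, Nat.cast_zero, mul_zero, add_zero]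
        · exfalso; apply hX
          obtain ⟨h1, h2, -, h4, h5⟩ := h
          exact Prod.ext h1 (Prod.ext (Prod.ext (Fin.ext h2) h4) h5)
        · rw [norm_zero, zero_mul]; exact zero_le_one
        · rw [norm_zero, zero_mul]
    _ = 1 := by rw [Finset.sum_ite_eq' Finset.univ X₀ (fun _ => (1 : ℝ)), if_pos (Finset.mem_univ _)]

end SrcTransfer

section Blocks

variable {L b M : ℕ} [NeZero L] [NeZero (b * L)] [NeZero M]

/-- **The re-analysis block is block covariant** for the canonical block structures of two consecutive sector counts: shifting both block indices by `δ` does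
not change `‖klReanalysis (b·L) M β μ K k‖` (k3c4-p1 g8 `norm_sectorOverlap_blockCovariant` at `klBlockEquiv_val/_snd`; the scalar `ε` factors).
[cite: BenfattoGiulianiMastropietro2006, §2.7 (2.71)] -/
theorem norm_klReanalysis_blockCovariant {β : ℝ} (hβ : β ≠ 0) (μ : ℝ) (K : TrigPolyC4v) (k : ℕ) (δ β' β₁ : Fin 2 → Fin b)
    (xbar : SpaceTimeIdx L M × SectorLeg (sectorCount (k + 1))) (y : SpaceTimeIdx L M × SectorLeg (sectorCount k)) :
    ‖klReanalysis (b * L) M β μ K k ((klBlockEquiv L b M (sectorCount (k + 1))).symm (β' + δ, xbar))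
        ((klBlockEquiv L b M (sectorCount k)).symm (β₁ + δ, y))‖ =
      ‖klReanalysis (b * L) M β μ K k ((klBlockEquiv L b M (sectorCount (k + 1))).symm (β', xbar))
        ((klBlockEquiv L b M (sectorCount k)).symm (β₁, y))‖ := by
  rw [klReanalysis_eq_smul, Matrix.smul_apply, Matrix.smul_apply, smul_eq_mul, smul_eq_mul, norm_mul, norm_mul,
    norm_sectorOverlap_blockCovariant (b := b) (L := L) (Lf := b * L) rfl hβ _ _ (klBlockEquiv L b M (sectorCount (k + 1)))
      (klBlockEquiv_val L b M (sectorCount (k + 1))) (klBlockEquiv_snd L b M (sectorCount (k + 1))) (klBlockEquiv L b M (sectorCount k))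
      (klBlockEquiv_val L b M (sectorCount k)) (klBlockEquiv_snd L b M (sectorCount k)) δ β' β₁ xbar y]

omit [NeZero M] in
/-- **The slot shift is block covariant** for the canonical block structures: both labels move by the same box-lattice vector `L·δ`
(`sectorBlock_symm_add_eq`), so "same site, slot `0`, same spin and charge" is unchanged. [folklore] -/
theorem klSlotShift_blockCovariant (k : ℕ) (δ β' β₁ : Fin 2 → Fin b)
    (xbar : SpaceTimeIdx L M × SectorLeg (sectorCount (k + 1))) (y : SpaceTimeIdx L M × SectorLeg (sectorCount k)) :
    klSlotShift (b * L) M k ((klBlockEquiv L b M (sectorCount (k + 1))).symm (β' + δ, xbar)) ((klBlockEquiv L b M (sectorCount k)).symm (β₁ + δ, y)) =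
      klSlotShift (b * L) M k ((klBlockEquiv L b M (sectorCount (k + 1))).symm (β', xbar)) ((klBlockEquiv L b M (sectorCount k)).symm (β₁, y)) := by
  rw [sectorBlock_symm_add_eq (Lf := b * L) rfl (klBlockEquiv L b M (sectorCount (k + 1))) (klBlockEquiv_val L b M (sectorCount (k + 1)))
      (klBlockEquiv_snd L b M (sectorCount (k + 1))) β' δ xbar,
    sectorBlock_symm_add_eq (Lf := b * L) rfl (klBlockEquiv L b M (sectorCount k)) (klBlockEquiv_val L b M (sectorCount k))
      (klBlockEquiv_snd L b M (sectorCount k)) β₁ δ y,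
    klSlotShift_apply, klSlotShift_apply]
  congr 1
  simp only [Prod.ext_iff, add_left_inj]

/-- **The doubled transfer `T⁺_k` is block covariant in norm** for the canonical DOUBLED block structures `klBlockEquivD L b M (k+1)` (out) and
`klBlockEquivD L b M k` (in). [cite: BenfattoGiulianiMastropietro2006, §2.7 (2.70)–(2.71)] -/
theorem norm_klSrcTransfer_blockCovariant {β : ℝ} (hβ : β ≠ 0) (μ : ℝ) (K : TrigPolyC4v) (k : ℕ) (δ β' β₁ : Fin 2 → Fin b)
    (xbar : SrcLabel L M (k + 1)) (y : SrcLabel L M k) :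
    ‖klSrcTransfer (b * L) M β μ K k ((klBlockEquivD L b M (k + 1)).symm (β' + δ, xbar)) ((klBlockEquivD L b M k).symm (β₁ + δ, y))‖ =
      ‖klSrcTransfer (b * L) M β μ K k ((klBlockEquivD L b M (k + 1)).symm (β', xbar)) ((klBlockEquivD L b M k).symm (β₁, y))‖ := by
  obtain ⟨x, s⟩ := xbar
  obtain ⟨y₀, s'⟩ := y
  rw [klBlockEquivD_symm_apply, klBlockEquivD_symm_apply, klBlockEquivD_symm_apply, klBlockEquivD_symm_apply, klSrcTransfer_apply,
    klSrcTransfer_apply]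
  dsimp only
  split_ifs with h0 h1
  · exact norm_klReanalysis_blockCovariant hβ μ K k δ β' β₁ x y₀
  · rw [klSlotShift_blockCovariant]
  · rfl

/-- **`TransferWtData` of the doubled transfer `T⁺_k` at ANY frame `K` from the weighted rows and columns of its re-analysis block**: if the
`klScaleWt (b·L) M β (k+1)`-weighted row and column sums of `klReanalysis (b·L) M β μ K k` are `≤ Cr`, then for every `0 ≤ Λ_T ≤ Λ_{k+1}`
`TransferWtData (klSrcTransfer (b·L) M β μ K k) (klBlockEquivD L b M (k+1)) (klBlockEquivD L b M k) Λ_T (Cr + 1)` (copy `0`: `1 + Λ_T·tnorm ≤ klScaleWt`,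
`…TwoVolumeDataKitWt.one_add_mul_tnorm_le_klScaleWt_pair`; copy `1`: the slot shift, rows/columns `≤ 1`; block covariance `norm_klSrcTransfer_blockCovariant`).
[cite: BenfattoGiulianiMastropietro2006, §2.7 (2.70)–(2.71a), §3 (3.2)–(3.8)] -/
theorem transferWtData_klSrcTransfer_of_rowColSumWt {β : ℝ} (hβ : 0 < β) (μ : ℝ) (K : TrigPolyC4v) (k : ℕ) {Cr ΛT : ℝ} (hCr : 0 ≤ Cr)
    (hΛT : 0 ≤ ΛT) (hΛTle : ΛT ≤ klScale klE0 (k + 1))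
    (hrow : ∀ X'' : SpaceTimeIdx (b * L) M × SectorLeg (sectorCount (k + 1)),
      ∑ X' : SpaceTimeIdx (b * L) M × SectorLeg (sectorCount k), ‖klReanalysis (b * L) M β μ K k X'' X'‖ *
        EngineV8.klScaleWt (b * L) M β (k + 1) {EngineV8.latticeLegPos (2 * (2 * M)) X'', EngineV8.latticeLegPos (2 * (2 * M)) X'} ≤ Cr)
    (hcol : ∀ X' : SpaceTimeIdx (b * L) M × SectorLeg (sectorCount k),
      ∑ X'' : SpaceTimeIdx (b * L) M × SectorLeg (sectorCount (k + 1)), ‖klReanalysis (b * L) M β μ K k X'' X'‖ *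
        EngineV8.klScaleWt (b * L) M β (k + 1) {EngineV8.latticeLegPos (2 * (2 * M)) X'', EngineV8.latticeLegPos (2 * (2 * M)) X'} ≤ Cr) :
    TransferWtData (klSrcTransfer (b * L) M β μ K k) (klBlockEquivD L b M (k + 1)) (klBlockEquivD L b M k) ΛT (Cr + 1) where
  ΛT_nonneg := hΛT
  cW_nonneg := by positivity
  row x := by
    obtain ⟨X'', c⟩ := x
    -- the re-analysis rows in the `1 + Λ_T·tnorm` currency
    have hre : ∑ X' : SpaceTimeIdx (b * L) M × SectorLeg (sectorCount k), ‖klReanalysis (b * L) M β μ K k X'' X'‖ *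
        (1 + ΛT * (Torus.tnorm (X''.1.2 - X'.1.2) : ℝ)) ≤ Cr := by
      refine le_trans (Finset.sum_le_sum fun X' _ => ?_) (hrow X'')
      -- `latticeLegPos` forgets the sector leg: compare `X''` through the leg `(X''.1, X'.2)` of the in-type
      exact mul_le_mul_of_nonneg_left
        (one_add_mul_tnorm_le_klScaleWt_pair hβ.le hΛTle ((X''.1, X'.2) : SpaceTimeIdx (b * L) M × SectorLeg (sectorCount k)) X')
        (norm_nonneg _)
    have hsh := sum_norm_klSlotShift_mul_wt_row_le (V := b * L) (M := M) k ΛT X''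
    revert c
    rw [Fin.forall_fin_two]
    refine ⟨?_, ?_⟩
    · rw [Fintype.sum_prod_type]
      simp_rw [Fin.sum_univ_two, klSrcTransfer_apply_zero_zero, klSrcTransfer_apply_zero_one, norm_zero, zero_mul, add_zero]
      linarith
    · rw [Fintype.sum_prod_type]
      simp_rw [Fin.sum_univ_two, klSrcTransfer_apply_one_zero, klSrcTransfer_apply_one_one, norm_zero, zero_mul, zero_add]
      linarith
  col y' := by
    obtain ⟨X', c'⟩ := y'
    have hre : ∑ X'' : SpaceTimeIdx (b * L) M × SectorLeg (sectorCount (k + 1)), ‖klReanalysis (b * L) M β μ K k X'' X'‖ *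
        (1 + ΛT * (Torus.tnorm (X''.1.2 - X'.1.2) : ℝ)) ≤ Cr := by
      refine le_trans (Finset.sum_le_sum fun X'' _ => ?_) (hcol X')
      exact mul_le_mul_of_nonneg_left
        (one_add_mul_tnorm_le_klScaleWt_pair hβ.le hΛTle ((X''.1, X'.2) : SpaceTimeIdx (b * L) M × SectorLeg (sectorCount k)) X')
        (norm_nonneg _)
    have hsh := sum_norm_klSlotShift_mul_wt_col_le (V := b * L) (M := M) k ΛT X'
    revert c'
    rw [Fin.forall_fin_two]
    refine ⟨?_, ?_⟩
    · rw [Fintype.sum_prod_type]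
      simp_rw [Fin.sum_univ_two, klSrcTransfer_apply_zero_zero, klSrcTransfer_apply_one_zero, norm_zero, zero_mul, add_zero]
      linarith
    · rw [Fintype.sum_prod_type]
      simp_rw [Fin.sum_univ_two, klSrcTransfer_apply_zero_one, klSrcTransfer_apply_one_one, norm_zero, zero_mul, zero_add]
      linarith
  cov δ β' β₁ xbar y := norm_klSrcTransfer_blockCovariant hβ.ne' μ K k δ β' β₁ xbar y

end Blocks

/-! ## §3 The door at the coarse flow frame -/

set_option maxHeartbeats 800000 in -- long binder list
/-- **M3b-j (iii), the transfer bundle, in the tower's vocabulary** — the `TowerCrossData.transfer` input of the W5 spine BY NAME: one constant `Cw ≥ 1` such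
that, at the coarse flow frame `K_n = klFlowFrameU L M β U μ n` (`1 ≤ n ≤ n_β + 1`, history `HistP klPredsV17F2 … 0 n`, `FrameOK … K_n`), on every fine lattice
`b·L` with `klEngL₃ β U ≤ b·L`, for every step `j ≤ n` (deep window `4ⁿ·U ≤ 4^{2j+d}` when `1 ≤ j`) and every rate `0 ≤ Λ_T ≤ Λ_j`:
`TransferWtData (klTowerTransfer (b·L) M β μ K_n j) (klBlockEquivD L b M j) (klBlockEquivD L b M (j−1)) Λ_T Cw`.  At `j = 0` the transfer is the identity
(§1); at `j = k+1` it is `T⁺_k` (§2) with p3 g12's ε-FREE weighted rows/columns of the re-analysis block `rowColSumWt_klReanalysis_klEng_flow_deep_vol (d)`.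
WINDOW CAVEAT («W2-HALF»): at the top frame only the steps `j ≥ (n + log₄U − d)/2` are served with `(j,d)`-uniform `Cw`; shallower steps go through the frame
telescope.  Scale bookkeeping only; nothing asserts any stub, K3, VL or superconductivity. [cite: BenfattoGiulianiMastropietro2006, §2.7 (2.70)–(2.71a), §3 (3.2)–(3.8)] -/
theorem transferWtData_klTowerTransfer_klEng_flow_deep_vol (dd : ℕ) :
    ∃ Cw : ℝ, 1 ≤ Cw ∧
      ∀ (G : GeoConsts) (P : SplitConsts) (R : RenConsts) (Q : EngConsts) (cc : ℝ), R.WF2 → 0 < cc → cc ≤ EngineV8.klEngC₃6 P R →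
      ∀ μ ∈ klWindowC, ∀ U : ℝ, 0 < U → U ≤ min (EngineV8.klEngU₀3 P R cc) (1 / (R.Gfr 3 + 1)) →
      ∀ β : ℝ, klBetaMin ≤ β → β ≤ Real.exp (cc / U ^ 2) →
      ∀ (L M : ℕ) [NeZero L] [NeZero M], EngineV8.klEngL₃ β U ≤ L → EngineV8.klEngM₃ β U L ≤ M →
      ∀ n : ℕ, 1 ≤ n → n ≤ nScales β + 1 →
        HistP klPredsV17F2 L M G P Q R β U μ 0 n → FrameOK R U (nScales β) μ (klFlowFrameU L M β U μ n) →
        ∀ (b : ℕ) [NeZero (b * L)], EngineV8.klEngL₃ β U ≤ b * L →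
        ∀ j : ℕ, j ≤ n → (1 ≤ j → (4 : ℝ) ^ n * U ≤ (4 : ℝ) ^ (2 * j + dd)) →
        ∀ ΛT : ℝ, 0 ≤ ΛT → ΛT ≤ klScale klE0 j →
          TransferWtData (klTowerTransfer (b * L) M β μ (klFlowFrameU L M β U μ n) j)
            (klBlockEquivD L b M j) (klBlockEquivD L b M (j - 1)) ΛT Cw := by
  obtain ⟨Cr, hCr, h⟩ := rowColSumWt_klReanalysis_klEng_flow_deep_vol dd
  refine ⟨Cr + 1, by linarith, ?_⟩
  intro G P R Q cc hR2 hcc hcc6 μ hμ U hU hUle β hβmin hβc L M _ _ hL3 hM3 n hn1 hnN hhist hfr b _ hV3 j hjn hwin ΛT hΛT0 hΛTle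
  have hβ0 : 0 < β := KLRegimeSplit.pos_of_klBetaMin_le hβmin
  cases j with
  | zero =>
    rw [klTowerTransfer_zero]
    exact transferWtData_one _ hΛT0 (by linarith)
  | succ k =>
    rw [klTowerTransfer_succ]
    obtain ⟨hrow, hcol⟩ := h G P R Q cc hR2 hcc hcc6 μ hμ U hU hUle β hβmin hβc L M hL3 hM3 n hn1 hnN hhist hfr (b * L) hV3 k hjn
      (hwin (Nat.succ_le_succ (Nat.zero_le k)))
    exact transferWtData_klSrcTransfer_of_rowColSumWt hβ0 μ _ k hCr.le hΛT0 hΛTle hrow hcol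

/-! ## §4 The transfer's frame mismatch in the tower's vocabulary (`TowerCrossData.trow` / `.tcol`)

The W5 spine also reads the rows and columns of `klTowerTransfer (b·L) M β μ Kf j − klTowerTransfer (b·L) M β μ Kc j` (fine frame `Kf` against the
coarse frame `Kc`).  At `j = 0` both transfers are the identity, so the mismatch vanishes; at `j = k+1` the slot-shift blocks are frame-free and cancel,
and the mismatch is the re-analysis mismatch `klReanalysis[Kf] k − klReanalysis[Kc] k` on copy `0` — entrywise the `T[K′] − T[K]` of k3c4-p2's
`exists_transfer_frameDefect_rate` (p587829) at `e₀ := klE0`, `n₁ := k+1`, `n₂ := k` (`klReanalysis_sub_apply_eq_frameDefect`). -/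

section Mismatch

variable {V M : ℕ} [NeZero V]

/-- **At step `0` the transfer mismatch vanishes (rows).** [folklore] -/
theorem sum_norm_klTowerTransfer_zero_sub_row (β μ : ℝ) (Kf Kc : TrigPolyC4v) (x : SrcLabel V M 0) :
    ∑ y : SrcLabel V M 0, ‖klTowerTransfer V M β μ Kf 0 x y - klTowerTransfer V M β μ Kc 0 x y‖ = 0 := by
  simp only [klTowerTransfer_zero, sub_self, norm_zero, Finset.sum_const_zero]

/-- **At step `0` the transfer mismatch vanishes (columns).** [folklore] -/
theorem sum_norm_klTowerTransfer_zero_sub_col (β μ : ℝ) (Kf Kc : TrigPolyC4v) (y : SrcLabel V M 0) :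
    ∑ x : SrcLabel V M 0, ‖klTowerTransfer V M β μ Kf 0 x y - klTowerTransfer V M β μ Kc 0 x y‖ = 0 := by
  simp only [klTowerTransfer_zero, sub_self, norm_zero, Finset.sum_const_zero]

/-- **The re-analysis mismatch is p587829's transfer frame defect**, entrywise: `klReanalysis[Kf] k − klReanalysis[Kc] k` is the difference of the
two `ε • (E(klAniso[K] (k+1))·S(bgmFat[K] k))` at `e₀ = klE0` (the `T[K′] x y − T[K] x y` of `exists_transfer_frameDefect_rate`). [folklore] -/
theorem klReanalysis_sub_apply_eq_frameDefect (β μ : ℝ) (Kf Kc : TrigPolyC4v) (k : ℕ)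
    (X'' : SpaceTimeIdx V M × SectorLeg (sectorCount (k + 1))) (X' : SpaceTimeIdx V M × SectorLeg (sectorCount k)) :
    klReanalysis V M β μ Kf k X'' X' - klReanalysis V M β μ Kc k X'' X' =
      ((((imagTimeWeight β M : ℝ) : ℂ)) • (sectorAnalysisMatrix V M β (klAnisoFamily V M β μ Kf klE0 (k + 1)) *
          sectorSubMatrix V M β (bgmFatMultiplier V M klE0 β (nambuXiCT V μ Kf) k))) X'' X' -
        ((((imagTimeWeight β M : ℝ) : ℂ)) • (sectorAnalysisMatrix V M β (klAnisoFamily V M β μ Kc klE0 (k + 1)) *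
          sectorSubMatrix V M β (bgmFatMultiplier V M klE0 β (nambuXiCT V μ Kc) k))) X'' X' := by
  rw [klReanalysis_eq_smul, klReanalysis_eq_smul]

/-- **At step `k+1` the rows of the transfer mismatch are the rows of the re-analysis mismatch**: if every row of
`klReanalysis V M β μ Kf k − klReanalysis V M β μ Kc k` is `≤ δ` (`0 ≤ δ`), so is every row of `klTowerTransfer … Kf (k+1) − klTowerTransfer … Kc (k+1)`
(copy `0`: the re-analysis blocks; copy `1`: the frame-free slot shifts cancel). [cite: BenfattoGiulianiMastropietro2006, §2.7 (2.71a), §3 (3.3)] -/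
theorem sum_norm_klTowerTransfer_succ_sub_row_le (β μ : ℝ) (Kf Kc : TrigPolyC4v) (k : ℕ) {δ : ℝ} (hδ : 0 ≤ δ)
    (hrow : ∀ X'' : SpaceTimeIdx V M × SectorLeg (sectorCount (k + 1)),
      ∑ X' : SpaceTimeIdx V M × SectorLeg (sectorCount k), ‖klReanalysis V M β μ Kf k X'' X' - klReanalysis V M β μ Kc k X'' X'‖ ≤ δ)
    (x : SrcLabel V M (k + 1)) :
    ∑ y : SrcLabel V M k, ‖klTowerTransfer V M β μ Kf (k + 1) x y - klTowerTransfer V M β μ Kc (k + 1) x y‖ ≤ δ := by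
  obtain ⟨X'', c⟩ := x
  rw [klTowerTransfer_succ, klTowerTransfer_succ]
  revert c
  rw [Fin.forall_fin_two]
  refine ⟨?_, ?_⟩
  · rw [Fintype.sum_prod_type]
    simp_rw [Fin.sum_univ_two, klSrcTransfer_apply_zero_zero, klSrcTransfer_apply_zero_one, sub_self, norm_zero, add_zero]
    exact hrow X''
  · rw [Fintype.sum_prod_type]
    simp_rw [Fin.sum_univ_two, klSrcTransfer_apply_one_zero, klSrcTransfer_apply_one_one, sub_self, norm_zero, add_zero,
      Finset.sum_const_zero]
    exact hδ

/-- **At step `k+1` the columns of the transfer mismatch are the columns of the re-analysis mismatch.**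
[cite: BenfattoGiulianiMastropietro2006, §2.7 (2.71a), §3 (3.3)] -/
theorem sum_norm_klTowerTransfer_succ_sub_col_le (β μ : ℝ) (Kf Kc : TrigPolyC4v) (k : ℕ) {δ : ℝ} (hδ : 0 ≤ δ)
    (hcol : ∀ X' : SpaceTimeIdx V M × SectorLeg (sectorCount k),
      ∑ X'' : SpaceTimeIdx V M × SectorLeg (sectorCount (k + 1)), ‖klReanalysis V M β μ Kf k X'' X' - klReanalysis V M β μ Kc k X'' X'‖ ≤ δ)
    (y : SrcLabel V M k) :
    ∑ x : SrcLabel V M (k + 1), ‖klTowerTransfer V M β μ Kf (k + 1) x y - klTowerTransfer V M β μ Kc (k + 1) x y‖ ≤ δ := by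
  obtain ⟨X', c'⟩ := y
  rw [klTowerTransfer_succ, klTowerTransfer_succ]
  revert c'
  rw [Fin.forall_fin_two]
  refine ⟨?_, ?_⟩
  · rw [Fintype.sum_prod_type]
    simp_rw [Fin.sum_univ_two, klSrcTransfer_apply_zero_zero, klSrcTransfer_apply_one_zero, sub_self, norm_zero, add_zero]
    exact hcol X'
  · rw [Fintype.sum_prod_type]
    simp_rw [Fin.sum_univ_two, klSrcTransfer_apply_zero_one, klSrcTransfer_apply_one_one, sub_self, norm_zero, zero_add,
      Finset.sum_const_zero]
    exact hδ

end Mismatch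

end Summit.HubbardSuperconductivity.HubbardSuperconductivity.Theorems.TorusFourierL2

end
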